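import Summits.RiemannHypothesis.RiemannHypothesis.Theorems.SpectralTraceWindowTraceArchStubXiAbsorptionAux2
import HarnessLib

/-!
# ξ absorbs the Weil distribution on the window (`stub_xiAbsorption`)

Stub `stub_xiAbsorption` of the line `causal-level-sets` for the crux `WindowTraceArch`
(stmt-RiemannHypothesis-11195; skeleton
`Summit.RiemannHypothesis.RiemannHypothesis.Cruxes.WindowTraceArch.CausalLevelSets`).

**Statement.** For `h > 1/2` and every Weil test `g`
(`Literature.NumberTheory.LFunctions.IsWeilTest`) with `tsupport g ⊆ [−log 2, log 2]`, writing
`ĝ(s) = weilMellin g s` (so `ĝ(1/2 + it) = ∫ g(x) e^{itx} dx`) and `ξ` for the completed zeta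
function `Literature.NumberTheory.LFunctions.riemannXi`,
`(1/π) ∫ ĝ(1/2 + it) Re (ξ'/ξ)(1/2 + h + it) dt = W(g) − ∫ g(x) m_h(x) dx`,
where `W = weilFunctional` is the Weil explicit-formula functional and
`m_h(x) = (1 − e^{−h|x|})(2cosh(x/2) − e^{−|x|/2}/(1 − e^{−2|x|}))` is the tame defect.

**Proof.** Everything happens in the half-plane of absolute convergence `Re s = 1/2 + h > 1`
(no zeros of `ζ` enter). Let `k = g + g(−·)`.
* (`…Aux2.lean`, `xiAbs_lhs`) Symmetrising (`Re F = ½(F + F̄)`, `ξ'/ξ(s̄) = conj ξ'/ξ(s)`,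
  `ĝ(1/2 − it) = ĝ(1 − (1/2 + it))`) gives `∫ ĝ Re ξ'/ξ = ½ ∫ (ξ'/ξ)(1/2+h+it) k̂(1/2+it) dt`; then
  `ξ'/ξ(s) = 1/s + 1/(s−1) − (log π)/2 + ½ψ(s/2) − Σ Λ(n)n^{-s}` (`logDeriv_riemannXi_eq_of_one_lt_re`):
  the polar pieces are `2π ∫₀^∞ k(x) e^{−hx}(e^{−x/2} + e^{x/2}) dx`
  (`integral_weilMellin_vertical_div_sub`), the constant gives `−2π log π · g(0)`, the prime
  pieces vanish (`∫ k̂(1/2+it) n^{-(1/2+h+it)} dt = 2π n^{-h} k(log n)/√n` and `k(±log n) = 0` for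
  `n ≥ 2` on the window).
* (`…Aux.lean`, `xiAbs_hasSum_digammaIntegral`) The digamma piece is Bombieri's computation with
  the digamma factor shifted by `h/2`:
  `∫ k̂(1/2+iy) ψ((1/2+h+iy)/2) dy + 2πγ k(0) = Σₙ (2π k(0)/(n+1) − 4π ∫₀^∞ k(x)e^{−(2n+h+1/2)x} dx)`.
* Here: Bombieri's form of the archimedean term (`weilArchTermBombieri_eq_weilArchTerm_holds`,
  `hasSum_integral_bombieriTerms`: `∫₀^∞ (e^{x/2}k − k(0))/(2 sinh x) = Σₙ (∫₀^∞ k e^{−(2n+1/2)x} − k(0)/(2n+1))`),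
  `weilPrimeTerm g = 0` on the window, `ĝ(0) + ĝ(1) = ∫₀^∞ k(x)(e^{−x/2} + e^{x/2}) dx`, the defect
  series `Σₙ ∫₀^∞ k(x)(1 − e^{−hx})e^{−(2n+1/2)x} dx = ∫₀^∞ k(x)(1 − e^{−hx}) e^{−x/2}/(1 − e^{−2x}) dx`
  (dominated convergence; `(1 − e^{−hx})/(1 − e^{−2x}) ≤ h/2 + 1`), the fold
  `∫ g m_h = ∫₀^∞ k m_h` (`m_h` even) and `Σₙ (2/(2n+1) − 1/(n+1)) = log 4`: the four series combine
  termwise to zero and the `g(0)` constants cancel exactly (`−log 4π + log π + log 4 = 0`).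

**Sources.** E. Bombieri, *Remarks on Weil's quadratic functional in the theory of prime numbers
I*, Rend. Mat. Acc. Lincei (9) 11 (2000), §2, (2.2)–(2.8) (right edge of the explicit-formula
contour and the archimedean term), as formalised in
`Literature/NumberTheory/LFunctions/WeilExplicitRightEdge.lean` and `…ArchTermProofs.lean`;
all ingredients are proved tree / Mathlib facts.
-/

set_option linter.dupNamespace false

noncomputable section

open Complex Set MeasureTheory Filter
open scoped Real Topology

namespace Summit.RiemannHypothesis.RiemannHypothesis.Theorems.SpectralTraceWindowTraceArch

open Literature.NumberTheory.LFunctions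

variable {g k : ℝ → ℂ} {h x : ℝ}

/-! ### The tame defect factor `(1 − e^{−hx})/(1 − e^{−2x})` -/

/-- For `x > 0`, `h ≥ 0`: `1 − e^{−hx} ≤ (h/2 + 1)(1 − e^{−2x})` (the singular factor
`1/(1 − e^{−2x}) ~ 1/(2x)` is tamed by `1 − e^{−hx} ≤ hx`). -/
theorem xiAbs_one_sub_exp_le (hx : 0 < x) (hh : 0 ≤ h) :
    1 - Real.exp (-(h * x)) ≤ (h / 2 + 1) * (1 - Real.exp (-(2 * x))) := by
  set u := Real.exp (-(h * x)) with hu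
  set v := Real.exp (-(2 * x)) with hv
  have hu1 : 1 - h * x ≤ u := by have := Real.add_one_le_exp (-(h * x)); linarith
  have hu0 : 0 < u := Real.exp_pos _
  have hv1 : v * (1 + 2 * x) ≤ 1 := by
    have h1 := Real.add_one_le_exp (2 * x)
    have h2 : v * Real.exp (2 * x) = 1 := by rw [hv, ← Real.exp_add]; simp
    nlinarith [Real.exp_pos (-(2 * x))]
  have h12x : 0 < 1 + 2 * x := by linarith
  have hA : (1 - u) * (1 + 2 * x) ≤ (h + 2) * x := by
    rcases le_or_gt (h * x) 1 with hhx | hhx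
    · nlinarith [mul_le_mul_of_nonneg_right hu1 h12x.le, mul_nonneg (sub_nonneg.2 hhx) hx.le]
    · nlinarith [mul_le_mul_of_nonneg_right (show 1 - u ≤ 1 by linarith) h12x.le]
  have hB : (h + 2) * x ≤ (h / 2 + 1) * (1 - v) * (1 + 2 * x) := by
    have := mul_le_mul_of_nonneg_left hv1 (by positivity : (0 : ℝ) ≤ h / 2 + 1)
    nlinarith
  exact le_of_mul_le_mul_right (hA.trans hB) h12x

/-- For `x > 0`, `h ≥ 0` the defect kernel `(1 − e^{−hx}) e^{−x/2}/(1 − e^{−2x})` lies in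
`[0, h/2 + 1]`. -/
theorem xiAbs_defect_bounds (hx : 0 < x) (hh : 0 ≤ h) :
    0 ≤ (1 - Real.exp (-(h * x))) * (Real.exp (-(x / 2)) / (1 - Real.exp (-(2 * x)))) ∧
      (1 - Real.exp (-(h * x))) * (Real.exp (-(x / 2)) / (1 - Real.exp (-(2 * x)))) ≤ h / 2 + 1 := by
  have hd : 0 < 1 - Real.exp (-(2 * x)) := by
    have := Real.exp_lt_one_iff.2 (show -(2 * x) < 0 by linarith); linarith
  have ha : 0 ≤ 1 - Real.exp (-(h * x)) := by
    have := Real.exp_le_one_iff.2 (show -(h * x) ≤ 0 by nlinarith); linarith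
  have he1 : Real.exp (-(x / 2)) ≤ 1 := Real.exp_le_one_iff.2 (by linarith)
  have hkey := xiAbs_one_sub_exp_le hx hh
  refine ⟨by positivity, ?_⟩
  rw [mul_div_assoc', div_le_iff₀ hd]
  nlinarith [mul_le_mul_of_nonneg_left he1 ha]

/-- The defect kernel `m_h` is even. -/
theorem xiAbs_mh_even (h x : ℝ) :
    (1 - Real.exp (-(h * |-x|))) *
        (2 * Real.cosh (-x / 2) - Real.exp (-(|-x| / 2)) / (1 - Real.exp (-(2 * |-x|)))) =
      (1 - Real.exp (-(h * |x|))) *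
        (2 * Real.cosh (x / 2) - Real.exp (-(|x| / 2)) / (1 - Real.exp (-(2 * |x|)))) := by
  rw [abs_neg, neg_div, Real.cosh_neg]

/-- `|m_h(x)| ≤ 2cosh(x/2) + h/2 + 1` for `h ≥ 0` (at `x = 0` the kernel is `0` by the junk
value of the division; elsewhere `xiAbs_defect_bounds`). -/
theorem xiAbs_abs_mh_le (hh : 0 ≤ h) (x : ℝ) :
    |(1 - Real.exp (-(h * |x|))) *
        (2 * Real.cosh (x / 2) - Real.exp (-(|x| / 2)) / (1 - Real.exp (-(2 * |x|))))| ≤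
      2 * Real.cosh (x / 2) + (h / 2 + 1) := by
  have hB : 0 ≤ 2 * Real.cosh (x / 2) := by positivity
  rcases eq_or_ne x 0 with rfl | hx0
  · simp; linarith
  · have ht : 0 < |x| := abs_pos.2 hx0
    obtain ⟨hC0, hC1⟩ := xiAbs_defect_bounds ht hh
    have ha0 : 0 ≤ 1 - Real.exp (-(h * |x|)) := by
      have := Real.exp_le_one_iff.2 (show -(h * |x|) ≤ 0 by nlinarith); linarith
    have ha1 : 1 - Real.exp (-(h * |x|)) ≤ 1 := by linarith [Real.exp_pos (-(h * |x|))]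
    rw [mul_sub, abs_le]
    constructor
    · nlinarith [mul_nonneg ha0 hB]
    · nlinarith [mul_le_of_le_one_left hB ha1]

/-- The defect kernel `m_h` is measurable. -/
theorem xiAbs_measurable_mh (h : ℝ) :
    Measurable fun x : ℝ ↦ (1 - Real.exp (-(h * |x|))) *
      (2 * Real.cosh (x / 2) - Real.exp (-(|x| / 2)) / (1 - Real.exp (-(2 * |x|)))) := by
  fun_prop

/-- `g · m_h` is integrable for a Weil test `g` and `h ≥ 0`. -/
theorem xiAbs_integrable_mul_mh (hg : IsWeilTest g) (hh : 0 ≤ h) :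
    Integrable fun x : ℝ ↦ g x * (((1 - Real.exp (-(h * |x|))) *
      (2 * Real.cosh (x / 2) - Real.exp (-(|x| / 2)) / (1 - Real.exp (-(2 * |x|)))) : ℝ) : ℂ) := by
  have hgc : Continuous g := hg.1.continuous
  have hmaj : Integrable fun x : ℝ ↦ ‖g x‖ * (2 * Real.cosh (x / 2) + (h / 2 + 1)) :=
    (hgc.norm.mul (by fun_prop)).integrable_of_hasCompactSupport hg.2.norm.mul_right
  refine hmaj.mono' ?_ (Eventually.of_forall fun x ↦ ?_)
  · exact (hgc.measurable.mul
      (Complex.measurable_ofReal.comp (xiAbs_measurable_mh h))).aestronglyMeasurable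
  · rw [norm_mul, Complex.norm_real, Real.norm_eq_abs]
    exact mul_le_mul_of_nonneg_left (xiAbs_abs_mh_le hh x) (norm_nonneg _)

/-- `k · (1 − e^{−hx}) e^{−x/2}/(1 − e^{−2x})` is integrable on `(0, ∞)` for a Weil test `k` and
`h ≥ 0`. -/
theorem xiAbs_integrableOn_defect (hk : IsWeilTest k) (hh : 0 ≤ h) :
    IntegrableOn (fun x : ℝ ↦ k x * (((1 - Real.exp (-(h * x))) *
      (Real.exp (-(x / 2)) / (1 - Real.exp (-(2 * x)))) : ℝ) : ℂ)) (Ioi 0) := by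
  have hkc : Continuous k := hk.1.continuous
  have hmaj : Integrable fun x : ℝ ↦ (h / 2 + 1) * ‖k x‖ :=
    (continuous_const.mul hkc.norm).integrable_of_hasCompactSupport hk.2.norm.mul_left
  refine hmaj.integrableOn.mono' ?_ ?_
  · refine ContinuousOn.aestronglyMeasurable ?_ measurableSet_Ioi
    refine hkc.continuousOn.mul (Complex.continuous_ofReal.comp_continuousOn ?_)
    refine ContinuousOn.mul (by fun_prop) (ContinuousOn.div (by fun_prop) (by fun_prop) ?_)
    intro x hx
    have : Real.exp (-(2 * x)) < 1 := Real.exp_lt_one_iff.2 (by simp only [mem_Ioi] at hx; linarith)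
    exact (sub_pos.2 this).ne'
  · refine (ae_restrict_iff' measurableSet_Ioi).2 (Eventually.of_forall fun x (hx : 0 < x) ↦ ?_)
    obtain ⟨h0, h1⟩ := xiAbs_defect_bounds hx hh
    rw [norm_mul, Complex.norm_real, Real.norm_eq_abs, abs_of_nonneg h0, mul_comm]
    exact mul_le_mul_of_nonneg_right h1 (norm_nonneg _)

/-! ### The defect series -/

/-- **Expansion of the defect integral**: for a Weil test `k` and `h ≥ 0`,
`Σₙ ∫₀^∞ (k(x)e^{−(2n+1/2)x} − k(x)e^{−(2n+h+1/2)x}) dx = ∫₀^∞ k(x)(1 − e^{−hx}) e^{−x/2}/(1 − e^{−2x}) dx`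
(`Σₙ e^{−2nx} = 1/(1 − e^{−2x})`, dominated convergence with the majorant
`‖k(x)‖(1 − e^{−hx})e^{−x/2}/(1 − e^{−2x}) ≤ (h/2 + 1)‖k(x)‖`). -/
theorem xiAbs_hasSum_integral_defect (hk : IsWeilTest k) (hh : 0 ≤ h) :
    HasSum (fun n : ℕ ↦ ∫ x in Ioi (0 : ℝ),
        (k x * cexp ((-(2 * (n : ℂ)) - 1 / 2) * x) - k x * cexp ((-(2 * (n : ℂ)) - h - 1 / 2) * x)))
      (∫ x in Ioi (0 : ℝ), k x * (((1 - Real.exp (-(h * x))) *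
        (Real.exp (-(x / 2)) / (1 - Real.exp (-(2 * x)))) : ℝ) : ℂ)) := by
  have hkc : Continuous k := hk.1.continuous
  -- the numerator `N(x) = k(x)(1 − e^{−hx})`
  set N : ℝ → ℂ := fun x ↦ k x * (((1 - Real.exp (-(h * x)) : ℝ)) : ℂ) with hN
  have hNc : Continuous N := by rw [hN]; fun_prop
  have hF : ∀ (n : ℕ) (x : ℝ),
      k x * cexp ((-(2 * (n : ℂ)) - 1 / 2) * x) - k x * cexp ((-(2 * (n : ℂ)) - h - 1 / 2) * x) =
        cexp ((-(2 * (n : ℂ)) - 1 / 2) * x) * N x := by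
    intro n x
    have e1 : cexp ((-(2 * (n : ℂ)) - h - 1 / 2) * x) =
        cexp ((-(2 * (n : ℂ)) - 1 / 2) * x) * cexp (-(h * x : ℝ) : ℂ) := by
      rw [← Complex.exp_add]
      congr 1
      push_cast
      ring
    rw [e1, hN]
    push_cast
    ring
  have hpowC : ∀ (n : ℕ) (x : ℝ), cexp ((-(2 * (n : ℂ)) - 1 / 2) * x) =
      cexp (-((x : ℂ) / 2)) * cexp (-(2 * (x : ℂ))) ^ n := by
    intro n x
    rw [← Complex.exp_nat_mul, ← Complex.exp_add]
    congr 1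
    ring
  have hpowR : ∀ (n : ℕ) (x : ℝ), Real.exp ((-(2 * (n : ℝ)) - 1 / 2) * x) =
      Real.exp (-(x / 2)) * Real.exp (-(2 * x)) ^ n := by
    intro n x
    rw [← Real.exp_nat_mul, ← Real.exp_add]
    congr 1
    ring
  have hnormF : ∀ (n : ℕ) (x : ℝ), ‖cexp ((-(2 * (n : ℂ)) - 1 / 2) * x)‖ =
      Real.exp ((-(2 * (n : ℝ)) - 1 / 2) * x) := by
    intro n x
    have hcast : ((-(2 * (n : ℂ)) - 1 / 2) * (x : ℂ)) = (((-(2 * (n : ℝ)) - 1 / 2) * x : ℝ) : ℂ) := by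
      push_cast; ring
    rw [hcast, Complex.norm_exp, Complex.ofReal_re]
  have hNnorm : ∀ x : ℝ, 0 < x → ‖N x‖ = ‖k x‖ * (1 - Real.exp (-(h * x))) := by
    intro x hx
    have ha : 0 ≤ 1 - Real.exp (-(h * x)) := by
      have := Real.exp_le_one_iff.2 (show -(h * x) ≤ 0 by nlinarith); linarith
    rw [hN, norm_mul, Complex.norm_real, Real.norm_eq_abs, abs_of_nonneg ha]
  simp_rw [hF]
  refine hasSum_integral_of_dominated_convergence
    (fun (n : ℕ) (x : ℝ) ↦ Real.exp ((-(2 * (n : ℝ)) - 1 / 2) * x) * ‖N x‖)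
    (fun n ↦ ?_) (fun n ↦ Eventually.of_forall fun x ↦ ?_) ?_ ?_ ?_
  · exact (by fun_prop : Continuous fun x : ℝ ↦ cexp ((-(2 * (n : ℂ)) - 1 / 2) * x) * N x).aestronglyMeasurable
  · rw [norm_mul, hnormF]
  · refine (ae_restrict_iff' measurableSet_Ioi).2 (Eventually.of_forall fun x (hx : 0 < x) ↦ ?_)
    have h0 : 0 ≤ Real.exp (-(2 * x)) := (Real.exp_pos _).le
    have h1 : Real.exp (-(2 * x)) < 1 := Real.exp_lt_one_iff.2 (by linarith)
    have e : (fun n : ℕ ↦ Real.exp ((-(2 * (n : ℝ)) - 1 / 2) * x) * ‖N x‖) =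
        fun n : ℕ ↦ Real.exp (-(x / 2)) * ‖N x‖ * Real.exp (-(2 * x)) ^ n := by
      funext n; rw [hpowR]; ring
    rw [e]
    exact (summable_geometric_of_lt_one h0 h1).mul_left _
  · have hI : IntegrableOn (fun x : ℝ ↦ ‖k x * (((1 - Real.exp (-(h * x))) *
        (Real.exp (-(x / 2)) / (1 - Real.exp (-(2 * x)))) : ℝ) : ℂ)‖) (Ioi 0) :=
      (xiAbs_integrableOn_defect hk hh).norm
    refine (hI.congr_fun (fun x (hx : 0 < x) ↦ ?_) measurableSet_Ioi).integrable
    have h0 : 0 ≤ Real.exp (-(2 * x)) := (Real.exp_pos _).le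
    have h1 : Real.exp (-(2 * x)) < 1 := Real.exp_lt_one_iff.2 (by linarith)
    obtain ⟨hb0, -⟩ := xiAbs_defect_bounds hx hh
    have e : (fun n : ℕ ↦ Real.exp ((-(2 * (n : ℝ)) - 1 / 2) * x) * ‖N x‖) =
        fun n : ℕ ↦ Real.exp (-(x / 2)) * ‖N x‖ * Real.exp (-(2 * x)) ^ n := by
      funext n; rw [hpowR]; ring
    show ‖k x * (((1 - Real.exp (-(h * x))) *
        (Real.exp (-(x / 2)) / (1 - Real.exp (-(2 * x)))) : ℝ) : ℂ)‖ =
      ∑' n : ℕ, Real.exp ((-(2 * (n : ℝ)) - 1 / 2) * x) * ‖N x‖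
    rw [e, tsum_mul_left, tsum_geometric_of_lt_one h0 h1, norm_mul, Complex.norm_real,
      Real.norm_eq_abs, abs_of_nonneg hb0, hNnorm x hx]
    have hd : 1 - Real.exp (-(2 * x)) ≠ 0 := (sub_pos.2 h1).ne'
    field_simp
  · refine (ae_restrict_iff' measurableSet_Ioi).2 (Eventually.of_forall fun x (hx : 0 < x) ↦ ?_)
    have hr : ‖cexp (-(2 * (x : ℂ)))‖ < 1 := by
      have hcast : (-(2 * (x : ℂ))) = ((-(2 * x) : ℝ) : ℂ) := by push_cast; ring
      rw [hcast, Complex.norm_exp, Complex.ofReal_re]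
      exact Real.exp_lt_one_iff.2 (by linarith)
    have hgeo := (hasSum_geometric_of_norm_lt_one hr).mul_left (cexp (-((x : ℂ) / 2)) * N x)
    have ef : (fun n : ℕ ↦ cexp ((-(2 * (n : ℂ)) - 1 / 2) * x) * N x) =
        fun n : ℕ ↦ cexp (-((x : ℂ) / 2)) * N x * cexp (-(2 * (x : ℂ))) ^ n := by
      funext n
      rw [hpowC]
      ring
    have ev : k x * (((1 - Real.exp (-(h * x))) *
        (Real.exp (-(x / 2)) / (1 - Real.exp (-(2 * x)))) : ℝ) : ℂ) =
        cexp (-((x : ℂ) / 2)) * N x * (1 - cexp (-(2 * (x : ℂ))))⁻¹ := by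
      rw [hN]
      push_cast
      ring
    rw [ef, ev]
    exact hgeo

/-! ### The main theorem -/

/-- **stub_xiAbsorption — ξ absorbs the Weil distribution on the window.** For `h > 1/2` and
every Weil test `g` supported in `[−log 2, log 2]`,
`(1/π) ∫ ĝ(1/2+it) Re(ξ'/ξ)(1/2+h+it) dt = W(g) − ∫ g(x) m_h(x) dx` with the tame defect
`m_h(x) = (1 − e^{−h|x|})(2cosh(x/2) − e^{−|x|/2}/(1 − e^{−2|x|}))`. -/
theorem stub_xiAbsorption :
    ∀ (h : ℝ), 1 / 2 < h → ∀ g : ℝ → ℂ, IsWeilTest g → tsupport g ⊆ Icc (-Real.log 2) (Real.log 2) →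
      (1 / (π : ℂ)) * ∫ t : ℝ, weilMellin g (1 / 2 + (t : ℂ) * I) *
          (((deriv riemannXi (1 / 2 + h + t * I) / riemannXi (1 / 2 + h + t * I)).re : ℝ) : ℂ)
        = weilFunctional g - ∫ x : ℝ, g x *
          (((1 - Real.exp (-(h * |x|))) *
            (2 * Real.cosh (x / 2) - Real.exp (-(|x| / 2)) / (1 - Real.exp (-(2 * |x|)))) : ℝ) : ℂ) := by
  intro h hh g hg hgs
  have hh0 : 0 ≤ h := by linarith
  have hk : IsWeilTest (weilSymm g) := hg.weilSymm
  have hgc : Continuous g := hg.1.continuous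
  have hkc : Continuous (weilSymm g) := hk.1.continuous
  -- (I) the critical-line integral in `x`-space (Aux2) and the digamma series (Aux)
  have hL := xiAbs_lhs g h hg hh hgs
  have h1 := xiAbs_hasSum_digammaIntegral (weilSymm g) h hk hh0
  rw [weilSymm_zero] at h1
  -- (II) Bombieri's integral as a series
  have h2 := hasSum_integral_bombieriTerms hk
  simp_rw [integral_bombieriTerm hk] at h2
  rw [weilSymm_zero] at h2
  -- (III) `log 4`
  have h3 := hasSum_two_div_sub_one_div
  -- (IV) the defect series
  have h4 := xiAbs_hasSum_integral_defect hk hh0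
  have iA : ∀ n : ℕ, IntegrableOn (fun x : ℝ ↦ weilSymm g x * cexp ((-(2 * (n : ℂ)) - 1 / 2) * x))
      (Ioi 0) := fun n ↦
    ((hkc.mul (by fun_prop)).integrable_of_hasCompactSupport hk.2.mul_right).integrableOn
  have iB : ∀ n : ℕ, IntegrableOn
      (fun x : ℝ ↦ weilSymm g x * cexp ((-(2 * (n : ℂ)) - h - 1 / 2) * x)) (Ioi 0) := fun n ↦
    ((hkc.mul (by fun_prop)).integrable_of_hasCompactSupport hk.2.mul_right).integrableOn
  simp_rw [integral_sub (iA _) (iB _)] at h4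
  -- combine: the series `h1 + 4π h2 − 4π h4 + 8π g(0) h3` vanishes termwise
  have hsum := ((h1.add (h2.mul_left (4 * π : ℂ))).add (h4.mul_left (-(4 * π) : ℂ))).add
    (h3.mul_left (4 * π * g 0 : ℂ))
  have hV := (show HasSum (fun _ : ℕ ↦ (0 : ℂ)) _ by
    convert hsum using 1
    funext n
    ring).unique hasSum_zero
  -- (V) the `x`-space bookkeeping: polar weight, fold of the even kernel `m_h`
  have hPW := integral_Ioi_add_comp_neg_mul_polarWeight hg
  have hfold := integral_Ioi_add_comp_neg_mul_eq (g := g)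
    (w := fun x : ℝ ↦ ((((1 - Real.exp (-(h * |x|))) *
      (2 * Real.cosh (x / 2) - Real.exp (-(|x| / 2)) / (1 - Real.exp (-(2 * |x|))))) : ℝ) : ℂ))
    (fun x ↦ congrArg _ (xiAbs_mh_even h x)) (xiAbs_integrable_mul_mh hg hh0)
  have iPM : IntegrableOn (fun x : ℝ ↦ (g x + g (-x)) *
      (((1 - Real.exp (-(h * x))) * (2 * Real.cosh (x / 2)) : ℝ) : ℂ)) (Ioi 0) :=
    ((hkc.mul (by fun_prop)).integrable_of_hasCompactSupport hk.2.mul_right).integrableOn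
  have iM := xiAbs_integrableOn_defect hk hh0
  have iPW : IntegrableOn (fun x : ℝ ↦ (g x + g (-x)) * (cexp (-(x : ℂ) / 2) + cexp ((x : ℂ) / 2)))
      (Ioi 0) :=
    ((hkc.mul (by fun_prop)).integrable_of_hasCompactSupport hk.2.mul_right).integrableOn
  have iP0 : IntegrableOn (fun x : ℝ ↦ weilSymm g x *
      (cexp ((-(h : ℂ) - 1 / 2) * x) + cexp ((1 / 2 - (h : ℂ)) * x))) (Ioi 0) :=
    ((hkc.mul (by fun_prop)).integrable_of_hasCompactSupport hk.2.mul_right).integrableOn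
  -- split `∫₀^∞ k m_h = PM − M`
  have hsplit : (∫ x in Ioi (0 : ℝ), (g x + g (-x)) * ((((1 - Real.exp (-(h * |x|))) *
      (2 * Real.cosh (x / 2) - Real.exp (-(|x| / 2)) / (1 - Real.exp (-(2 * |x|))))) : ℝ) : ℂ)) =
      (∫ x in Ioi (0 : ℝ), (g x + g (-x)) *
        (((1 - Real.exp (-(h * x))) * (2 * Real.cosh (x / 2)) : ℝ) : ℂ)) -
      ∫ x in Ioi (0 : ℝ), weilSymm g x * (((1 - Real.exp (-(h * x))) *
        (Real.exp (-(x / 2)) / (1 - Real.exp (-(2 * x)))) : ℝ) : ℂ) := by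
    rw [← integral_sub iPM iM]
    refine setIntegral_congr_fun measurableSet_Ioi fun x (hx : 0 < x) ↦ ?_
    simp only [weilSymm, abs_of_pos hx]
    push_cast
    ring
  -- `PM = PW − P0`
  have hPM : (∫ x in Ioi (0 : ℝ), (g x + g (-x)) *
        (((1 - Real.exp (-(h * x))) * (2 * Real.cosh (x / 2)) : ℝ) : ℂ)) =
      (∫ x in Ioi (0 : ℝ), (g x + g (-x)) * (cexp (-(x : ℂ) / 2) + cexp ((x : ℂ) / 2))) -
      ∫ x in Ioi (0 : ℝ), weilSymm g x *
        (cexp ((-(h : ℂ) - 1 / 2) * x) + cexp ((1 / 2 - (h : ℂ)) * x)) := by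
    rw [← integral_sub iPW iP0]
    refine setIntegral_congr_fun measurableSet_Ioi fun x _ ↦ ?_
    have e1 : cexp ((-(h : ℂ) - 1 / 2) * x) = cexp (-((h * x : ℝ) : ℂ)) * cexp (-(x : ℂ) / 2) := by
      rw [← Complex.exp_add]; congr 1; push_cast; ring
    have e2 : cexp ((1 / 2 - (h : ℂ)) * x) = cexp (-((h * x : ℝ) : ℂ)) * cexp ((x : ℂ) / 2) := by
      rw [← Complex.exp_add]; congr 1; push_cast; ring
    have e3 : (((1 - Real.exp (-(h * x))) * (2 * Real.cosh (x / 2)) : ℝ) : ℂ) =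
        (1 - cexp (-((h * x : ℝ) : ℂ))) * (cexp ((x : ℂ) / 2) + cexp (-(x : ℂ) / 2)) := by
      push_cast
      rw [Complex.two_cosh, neg_div]
    simp only [weilSymm]
    rw [e1, e2, e3]
    ring
  -- (VI) assemble
  have hprime : weilPrimeTerm g = 0 := weilPrimeTerm_eq_zero_of_tsupport_subset hgc hgs
  have harch : weilArchTerm g = weilArchTermBombieri g :=
    (weilArchTermBombieri_eq_weilArchTerm_holds hg).symm
  have hB : weilArchTermBombieri g =
      -(Real.log (4 * π) + Real.eulerMascheroniConstant : ℂ) * g 0 -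
        ∫ x in Ioi (0 : ℝ), ((Real.exp (x / 2) : ℂ) * weilSymm g x - 2 * g 0) /
          (2 * Real.sinh x : ℂ) := by
    rw [weilArchTermBombieri_eq]
    rfl
  have hπ : (π : ℂ) ≠ 0 := Complex.ofReal_ne_zero.2 Real.pi_ne_zero
  rw [hL, ← hfold, hsplit, hPM, hPW, weilFunctional, hprime, harch, hB, weilPolarTerm,
    Real.log_mul (by norm_num) Real.pi_ne_zero, Complex.ofReal_add]
  set Dint := ∫ y : ℝ, weilMellin (weilSymm g) (((1 / 2 : ℝ) : ℂ) + y * I) *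
    digamma ((((1 / 2 : ℝ) : ℂ) + y * I) / 2 + (h : ℂ) / 2) with hDdef
  set Bint := ∫ x in Ioi (0 : ℝ), ((Real.exp (x / 2) : ℂ) * weilSymm g x - 2 * g 0) /
    (2 * Real.sinh x : ℂ) with hBdef
  set Mint := ∫ x in Ioi (0 : ℝ), weilSymm g x * (((1 - Real.exp (-(h * x))) *
    (Real.exp (-(x / 2)) / (1 - Real.exp (-(2 * x)))) : ℝ) : ℂ) with hMdef
  have hD : Dint = 4 * π * (-(Real.eulerMascheroniConstant : ℂ) * g 0 - Bint + Mint -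
      g 0 * ((Real.log 4 : ℝ) : ℂ)) := by
    linear_combination hV
  rw [hD]
  field_simp
  ring
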